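import Literature.Geometry.Manifold.CircleMapForm
import Literature.AlgebraicTopology.SingularHomology.CircleMapWinding
import HarnessLib

/-!
# Periods of `dφ` over closed curves are windings of `φ`

Topic `Literature/Geometry/Manifold`; proofs-only bridge between
`Literature/Geometry/Manifold/CircleMapForm.lean` (the closed `1`-form `dφ = circleMapForm I φ hφ`
of a circle-valued map `φ` with smooth local real lifts; `∫ₐᵇ dφ(γ̇) = Λ(b) − Λ(a)` for a global
lift `Λ` of `φ ∘ γ`) and `Literature/AlgebraicTopology/SingularHomology/CircleMapWinding.lean`
(`windAlong φ P`, the lift increment of `φ ∘ P` for a path `P`; on loops, the value of the winding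
functional `⟨φ^*θ, ·⟩` on the Hurewicz class).  Bott–Tu 1982, §2 / Hatcher 2002, Thm. 1.7 in the
form: **the period of `dφ` over a closed smooth curve is the degree of `φ` along it**.

* `hasLifts_comp` — smooth local lifts pull back along smooth maps (`φ ∘ f` has lifts `F ∘ f`);
* `windAlong_comp` — `windAlong (φ ∘ f) P = windAlong φ (f ∘ P)`;
* **`integral_circleMapForm_eq_windAlong`** — for a smooth curve `γ : ℝ → M` and `T`, and any
  path `P` of `M` with `P s = γ (T s)`:  `∫₀ᵀ dφ(γ̇) dt = windAlong φ P`;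
* `integral_circleMapForm_ne_zero_of_windAlong_ne_zero` — hence a non-zero winding gives a
  non-zero period: the hypothesis `∮_γ η ≠ 0` of the Legendrian-realisation brick
  `Literature/Geometry/Symplectic/LegendrianRealisationOnPage.lean`, fed (for the Lefschetz base) by
  `LefschetzBase.exists_windAlong_phi_ne_zero_of_shadow_ne_zero`.

Everything is proved; no definitions, no named facts.

## References
* R. Bott, L. W. Tu, *Differential Forms in Algebraic Topology* (1982), §2 Prop. 2.3. [BottTu1982Forms]
* A. Hatcher, *Algebraic Topology* (2002), Thm. 1.7, §3.1 p. 198. [HatcherAT2002]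
-/

noncomputable section

open scoped Manifold ContDiff Topology
open Set Function Filter
open Literature.AlgebraicTopology.SingularHomology

namespace Literature.Geometry.Manifold

variable {E : Type*} [NormedAddCommGroup E] [NormedSpace ℝ E] {H : Type*} [TopologicalSpace H]
  {I : ModelWithCorners ℝ E H} {M : Type} [TopologicalSpace M] [ChartedSpace H M]
variable {E' : Type*} [NormedAddCommGroup E'] [NormedSpace ℝ E'] {H' : Type*} [TopologicalSpace H']
  {I' : ModelWithCorners ℝ E' H'} {N : Type} [TopologicalSpace N] [ChartedSpace H' N]

/-! ### Lifts pull back; windings push forward -/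

/-- **Smooth local lifts pull back along smooth maps**: if `φ = F mod 1` near each point with `F`
smooth, then `φ ∘ f = (F ∘ f) mod 1` near each point with `F ∘ f` smooth. [folklore] -/
theorem hasLifts_comp {φ : M → UnitAddCircle}
    (hφ : ∀ p, ∃ (W : Set M) (F : M → ℝ), IsOpen W ∧ p ∈ W ∧
      (∀ q ∈ W, ContMDiffAt I 𝓘(ℝ, ℝ) ∞ F q) ∧ ∀ q ∈ W, φ q = ((F q : ℝ) : UnitAddCircle))
    {f : N → M} (hf : ContMDiff I' I ∞ f) (p : N) :
    ∃ (W : Set N) (F : N → ℝ), IsOpen W ∧ p ∈ W ∧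
      (∀ q ∈ W, ContMDiffAt I' 𝓘(ℝ, ℝ) ∞ F q) ∧ ∀ q ∈ W, (φ ∘ f) q = ((F q : ℝ) : UnitAddCircle) := by
  obtain ⟨W, F, hW, hp, hF, hl⟩ := hφ (f p)
  exact ⟨f ⁻¹' W, F ∘ f, hW.preimage hf.continuous, hp,
    fun q hq => (hF _ hq).comp q (hf q), fun q hq => hl _ hq⟩

/-- **`windAlong (φ ∘ f) P = windAlong φ (f ∘ P)`.** [folklore] -/
theorem windAlong_comp {X Y : Type} [TopologicalSpace X] [TopologicalSpace Y]
    (φ : C(Y, UnitAddCircle)) (f : C(X, Y)) {x y : X} (P : Path x y) :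
    windAlong (φ.comp f) P = windAlong φ (P.map f.continuous) := by
  unfold windAlong
  congr 1

/-! ### The period of `dφ` along a closed curve is the winding of `φ` -/

variable [IsManifold I ∞ M] {φ : M → UnitAddCircle}
  {hφ : ∀ p, ∃ (W : Set M) (F : M → ℝ), IsOpen W ∧ p ∈ W ∧
    (∀ q ∈ W, ContMDiffAt I 𝓘(ℝ, ℝ) ∞ F q) ∧ ∀ q ∈ W, φ q = ((F q : ℝ) : UnitAddCircle)}

/-- **`∫₀ᵀ dφ(γ̇) dt = windAlong φ P`** for a smooth curve `γ` and any path `P` reparametrising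
`γ|[0, T]` (`P s = γ (T s)`): the global lift `Λ` of `φ ∘ γ` (`exists_lift_along`) computes the
integral as `Λ(T) − Λ(0)`, and `s ↦ Λ(T s)` is a continuous lift of `φ ∘ P`, which computes the
winding (`liftIncrement_eq_of_lift`). [cite: BottTu1982Forms, §2 Prop. 2.3] -/
theorem integral_circleMapForm_eq_windAlong (hφc : Continuous φ) {γ : ℝ → M}
    (hγ : ContMDiff 𝓘(ℝ, ℝ) I ∞ γ) (T : ℝ) {x : M} (P : Path x x) (hP : ∀ s : unitInterval, P s = γ (T * s)) :
    (∫ t in (0 : ℝ)..T, circleMapForm I φ hφ (γ t) ![mfderiv 𝓘(ℝ, ℝ) I γ t (1 : ℝ)]) =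
      windAlong ⟨φ, hφc⟩ P := by
  obtain ⟨Λ, hlift, hΛ⟩ := exists_lift_along (hφ := hφ) hγ
  rw [integral_circleMapForm_velocity hγ hΛ 0 T]
  have hΛc : Continuous Λ := continuous_iff_continuousAt.2 fun t => (hΛ t).continuousAt
  set G : C(unitInterval, ℝ) :=
    ⟨fun s => Λ (T * s), hΛc.comp (continuous_const.mul continuous_subtype_val)⟩
    with hG
  have hGl : ∀ s, ((G s : ℝ) : UnitAddCircle) = (P.map (⟨φ, hφc⟩ : C(M, UnitAddCircle)).continuous) s :=
    fun s => by
      show ((Λ (T * s) : ℝ) : UnitAddCircle) = φ (P s)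
      rw [hlift, hP s]
  rw [windAlong, liftIncrement_eq_of_lift _ G hGl]
  show Λ T - Λ 0 = Λ (T * (1 : unitInterval)) - Λ (T * (0 : unitInterval))
  rw [Set.Icc.coe_one, Set.Icc.coe_zero, mul_one, mul_zero]

/-- **A non-zero winding gives a non-zero period.** [cite: BottTu1982Forms, §2 Prop. 2.3] -/
theorem integral_circleMapForm_ne_zero_of_windAlong_ne_zero (hφc : Continuous φ) {γ : ℝ → M}
    (hγ : ContMDiff 𝓘(ℝ, ℝ) I ∞ γ) (T : ℝ) {x : M} (P : Path x x) (hP : ∀ s : unitInterval, P s = γ (T * s))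
    (hw : windAlong ⟨φ, hφc⟩ P ≠ 0) :
    (∫ t in (0 : ℝ)..T, circleMapForm I φ hφ (γ t) ![mfderiv 𝓘(ℝ, ℝ) I γ t (1 : ℝ)]) ≠ 0 := by
  rwa [integral_circleMapForm_eq_windAlong hφc hγ T P hP]

/-- **The period of `dφ` over a closed curve is the value of the winding functional on its
class**: `∫₀ᵀ dφ(γ̇) = W_φ(h P)` for any loop `P` reparametrising `γ|[0,T]`.
[cite: HatcherAT2002, §3.1 p. 198] -/
theorem integral_circleMapForm_eq_windingFunctional (hφc : Continuous φ) {γ : ℝ → M}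
    (hγ : ContMDiff 𝓘(ℝ, ℝ) I ∞ γ) (T : ℝ) {x : M} (P : Path x x) (hP : ∀ s : unitInterval, P s = γ (T * s)) :
    (∫ t in (0 : ℝ)..T, circleMapForm I φ hφ (γ t) ![mfderiv 𝓘(ℝ, ℝ) I γ t (1 : ℝ)]) =
      windingFunctional ⟨φ, hφc⟩ (loopClass ℤ ℤ (1 : ℤ) P) := by
  rw [integral_circleMapForm_eq_windAlong hφc hγ T P hP, windingFunctional_loopClass]

end Literature.Geometry.Manifold
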